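import Literature.AnabelianGeometry.EtaleTheta.Discharge.Sec4Prop42SubHullClauses
import Literature.AlgebraicGeometry.Frobenioids.PadicKummerRemark221Tri
import Literature.AlgebraicGeometry.Frobenioids.PadicKummerSettingProofs
import HarnessLib

/-!
# [EtTh] Prop. 4.2 (iii) ∧ (iv) at the FAITHFUL [FrdII] Def. 2.2 (ii) saturation slot over `B^temp(Π^tp_X)⁰`, WITH THE
# ARITHMETIC BINDING: the [FrdII] Rmk. 2.2.1 root input `h221` DISCHARGED by layer L1

S. Mochizuki, *The étale theta function and its Frobenioid-theoretic manifestations*, Publ. RIMS **45** (2009)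
[MochizukiEtTh2009], §4, Prop. 4.2 (iii)/(iv), PDF pp.88–90 (p.90 L10–17: «[FrdII], Remark 2.2.1 [concerning the issue of
(N, H_⊙^{bs-fld})-saturation]» … «admits an `N`-th root»).  S. Mochizuki, *The geometry of Frobenioids II* [MochizukiFrdII2008],
Rmk. 2.2.1 p.18 («`A_E = Spec(L)` … we have a natural isomorphism `(O^□(A) ⊇) O^□(A)^H ⥲ O^□(L^H)` … any element
`f ∈ O^□(A)^H` admits an `N`-th root `g ∈ O^□(A)`»), Def. 2.2 (iii) p.18 (`O^□ = O^⊳` or `O^×`).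
[cite: MochizukiEtTh2009, Prop 4.2 p.90] [cite: MochizukiFrdII2008, Rmk 2.2.1 p.18]

abc-iut cell, layer L2, DAG nodes `EtTh:Prop4.2(iii)` / `EtTh:Prop4.2(iv)`; seat abc-iut-w4-d044 (gen 5).  PROOF-ONLY (0 `def`s;
nothing landed is edited or restated).  `Sec4Prop42SubHullClauses.lean` (this lineage, p466882) closed the node floor at the
faithful slot modulo {`Φ` divisorial, `hDSpull`, `hR`} ∪ {B2 data `haug`/`act`/`hact`} ∪ {[FrdII] Rmk. 2.2.1 ×2 AT THE INSTANCE BY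
NAME: `hex` (saturated pull-backs exist in `C`) and `h221` = `PadicKummer.SaturatedInvariantsAdmitRoots (def22Ctx A″) N` for the
Frobenius-trivial `A″` over `A_⊙`}.  The second is a FACT-LIST row (F-1198) whose universal closure is refuted (an abstract Def. 2.2
context need not satisfy it) but which layer L1 PROVED at the arithmetic contexts `Def22Context.ofLocalField L H hH O^□_L`
(abc-iut-L1-t7's `saturatedInvariantsAdmitRoots_ofLocalField_box`) — precisely print's situation «`A_E = Spec(L)`».  Here the
binder `h221` is therefore REPLACED by the ARITHMETIC BINDING `harith` (this lineage's gen-4 shape, p457351 §D): «the Def. 2.2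
context of every Frobenius-trivial `A″` over `A_⊙` is isomorphic ([FrdII] Def. 2.2 context isomorphism, abc-iut-L1-d4's
`Def22Context.Iso`) to the arithmetic context of a finite Galois `L ⊆ K̄` with `Gal(K̄/L) ≤ H_⊙^{bs-fld}`» (`K` of characteristic
`0` with a valuative structure), and `h221` is obtained by transport (`Def22Context.Iso.saturatedInvariantsAdmitRoots_iff`):
* `Prop42Sub.prop42_iii_iv_mkOfConnectedTemperoid_faithful_arith` — ⟸ {`Φ` divisorial, `hDSpull` (G-w5d063-1), `hR` (G-w4d044-3)}
  ∪ {B2 data} ∪ {`hex`, `harith`}; NO binder headed by a refuted-closure FACT row (the K4 / C-R33 shape: the Rmk. 2.2.1 root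
  fact enters as L1's THEOREM at `ofLocalField`, not as an assumption);
  (over the canonical base-category vocabulary `treeCatVocab` supply `hΦd := tf.isDivisorial_divisorMonoid`).
What is NOT done here (honest census): `harith` itself — the identification of `aug_* A″^bs ∈ B(G_K)⁰`, `Aut_E`, `O^×(A″)` with
`Spec` of the base field of `A″` and its units — is a property of the GIVEN tempered Frobenioid `tf` (abstract here), provable
only at an arithmetic model carrying genuine constant fields; `hex` likewise.  HONEST FRAMING: [EtTh]/[FrdII] are refereed
prerequisite papers; typed ≠ proved for the binders; nothing here bears on, or takes a side on, the disputed [IUTchIII] Cor. 3.12;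
nothing here asserts abc proved or refuted.
-/

noncomputable section

namespace Literature.AnabelianGeometry.EtaleTheta

open CategoryTheory Opposite Literature.AlgebraicGeometry.Frobenioids Literature.AnabelianGeometry.SemiGraphs
  Literature.AlgebraicGeometry.Frobenioids.QuasiTemperoid.BTempConnected
open Literature.NumberTheory.GaloisRepresentations.LocalWeilDatum (galFixing)

namespace BiKummerSetting

section FaithfulArith

variable {K : Type} [Field K] [ValuativeRel K] [CharZero K] (X : SemiGraphs.TemperedArithmeticGroup.{0} K) {D₀ : Type}
  [Category.{0} D₀] {V : FrdIMonoidStub.{0}} {T₀ : RealifiedDivisorMonoids (D₀ := D₀) V}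
  {VD : FrdICatStub.{1, 0, 0} (ConnectedPart (BTemp X.Pi))}
  (tf : TemperedFrobenioid T₀ (ConnectedPart (BTemp X.Pi)) VD) (hZ : tf.monoidType = MonoidType.Z)
  (hP : ∀ A : (ConnectedPart (BTemp X.Pi))ᵒᵖ, IsPerfect (tf.Φ.carrier A))
  (haug : IsOpenMap X.aug)
  (act : ∀ A : tf.category, MulDistribMulAction (Aut (TemperedFrobenioid.AE X tf haug A)) ↥(tf.units A))
  (hact : ∀ (A : tf.category) (α : Aut A) (u : ↥(tf.units A)), (TemperedFrobenioid.resE X tf haug A α) • u =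
    (⟨α * u.1 * α⁻¹, (tf.units_normal A).conj_mem _ u.2 α⟩ : ↥(tf.units A)))
  (A₀ : tf.category) (hA₀ : PreFrobenioid.IsFrobeniusTrivial tf.toElem A₀) (hA₀' : SemiGraphs.IsGaloisObj A₀.base.obj)
  (fs : Prop)
  (hDSpull : ∀ {A A' : ConnectedPart (BTemp X.Pi)} (e : A' ⟶ A) {a b : tf.Φ.carrier (op A)},
    (∀ x : tf.Φ.carrier (op A), x ∣ a → x ∣ b → x = 1) →
      ∀ y : tf.Φ.carrier (op A'), y ∣ pull tf.divisorMonoid e a → y ∣ pull tf.divisorMonoid e b → y = 1)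
  (hR : ∀ (N : ℕ+) (A : ConnectedPart (BTemp X.Pi)), SemiGraphs.IsGaloisObj A.obj →
    ∀ f : tf.ratFnFunctor.obj (op A),
      ∃ (A' : ConnectedPart (BTemp X.Pi)) (_ : SemiGraphs.IsGaloisObj A'.obj) (b : A' ⟶ A)
        (g : tf.ratFnFunctor.obj (op A')), g ^ (N : ℕ) = pull tf.ratFnFunctor b f)
  (hex : ∀ (A' : tf.category) (N : ℕ+), ∃ (A'' : tf.category) (ψ : A'' ⟶ A'),
    PreFrobenioid.IsPullbackMorphism tf.toElem ψ ∧
      PadicKummer.IsNHSaturated (TemperedFrobenioid.def22Ctx X tf haug A'' (act A'') (hact A'')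
        (mkOfConnectedTemperoid X tf hZ hP (fun H A N => ∃ (hn : H.Normal)
            (ho : IsOpen (H : Set (Field.absoluteGaloisGroup K))),
            PadicKummer.IsNHSaturated (TemperedFrobenioid.def22Ctx X tf haug A (act A) (hact A) H hn ho) N)
          A₀ hA₀ hA₀').HodotBsFld
        (mkOfConnectedTemperoid X tf hZ hP (fun _ _ _ => True) A₀ hA₀ hA₀').hodotBsFld_normal
        ((mkOfConnectedTemperoid X tf hZ hP (fun _ _ _ => True) A₀ hA₀ hA₀').isOpen_hodotBsFld_of_isOpenMap
          (isOpen_Hodot_mkOfConnectedTemperoid X tf hZ hP _ A₀ hA₀ hA₀') haug)) N)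
  (harith : ∀ (A'' : tf.category), (A''.base ⟶ A₀.base) → PreFrobenioid.IsFrobeniusTrivial tf.toElem A'' →
    ∃ (L : IntermediateField K (AlgebraicClosure K)) (hfd : FiniteDimensional K L) (hn : Normal K L),
      galFixing K L ≤ (mkOfConnectedTemperoid X tf hZ hP (fun _ _ _ => True) A₀ hA₀ hA₀').HodotBsFld ∧
      Nonempty (PadicKummer.Def22Context.Iso
        (TemperedFrobenioid.def22Ctx X tf haug A'' (act A'') (hact A'')
          (mkOfConnectedTemperoid X tf hZ hP (fun _ _ _ => True) A₀ hA₀ hA₀').HodotBsFld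
          (mkOfConnectedTemperoid X tf hZ hP (fun _ _ _ => True) A₀ hA₀ hA₀').hodotBsFld_normal
          ((mkOfConnectedTemperoid X tf hZ hP (fun _ _ _ => True) A₀ hA₀ hA₀').isOpen_hodotBsFld_of_isOpenMap
            (isOpen_Hodot_mkOfConnectedTemperoid X tf hZ hP _ A₀ hA₀ hA₀') haug))
        (@PadicKummer.Def22Context.ofLocalField K _ L hn hfd
          (mkOfConnectedTemperoid X tf hZ hP (fun _ _ _ => True) A₀ hA₀ hA₀').HodotBsFld
          (mkOfConnectedTemperoid X tf hZ hP (fun _ _ _ => True) A₀ hA₀ hA₀').hodotBsFld_normal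
          ((mkOfConnectedTemperoid X tf hZ hP (fun _ _ _ => True) A₀ hA₀ hA₀').isOpen_hodotBsFld_of_isOpenMap
            (isOpen_Hodot_mkOfConnectedTemperoid X tf hZ hP _ A₀ hA₀ hA₀') haug)
          (PadicKummer.boxStableSubmonoid K L fs))))

include harith in
/-- **The [FrdII] Rmk. 2.2.1 root input `h221` at the B2 datum ⟸ the ARITHMETIC BINDING `harith`**: transport of
abc-iut-L1-t7's THEOREM `saturatedInvariantsAdmitRoots_ofLocalField_box` («`A_E = Spec(L)`», `Gal(K̄/L) ≤ H`) along the
context isomorphism (abc-iut-L1-d4's `Def22Context.Iso.saturatedInvariantsAdmitRoots_iff`). [cite: MochizukiFrdII2008, Rmk 2.2.1 p.18] -/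
theorem Prop42Sub.h221_of_arith :
    ∀ (A'' : tf.category) (N : ℕ+), (A''.base ⟶ A₀.base) → PreFrobenioid.IsFrobeniusTrivial tf.toElem A'' →
      PadicKummer.SaturatedInvariantsAdmitRoots (TemperedFrobenioid.def22Ctx X tf haug A'' (act A'') (hact A'')
          (mkOfConnectedTemperoid X tf hZ hP (fun H A N => ∃ (hn : H.Normal)
              (ho : IsOpen (H : Set (Field.absoluteGaloisGroup K))),
              PadicKummer.IsNHSaturated (TemperedFrobenioid.def22Ctx X tf haug A (act A) (hact A) H hn ho) N)
            A₀ hA₀ hA₀').HodotBsFld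
          (mkOfConnectedTemperoid X tf hZ hP (fun _ _ _ => True) A₀ hA₀ hA₀').hodotBsFld_normal
          ((mkOfConnectedTemperoid X tf hZ hP (fun _ _ _ => True) A₀ hA₀ hA₀').isOpen_hodotBsFld_of_isOpenMap
            (isOpen_Hodot_mkOfConnectedTemperoid X tf hZ hP _ A₀ hA₀ hA₀') haug)) N := by
  intro A'' N b hft
  obtain ⟨L, hfd, hn, hHL, ⟨e⟩⟩ := harith A'' b hft
  haveI := (mkOfConnectedTemperoid X tf hZ hP (fun _ _ _ => True) A₀ hA₀ hA₀').hodotBsFld_normal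
  exact (e.saturatedInvariantsAdmitRoots_iff (N : ℕ)).mpr
    (PadicKummer.Def22Context.saturatedInvariantsAdmitRoots_ofLocalField_box L (N : ℕ) _ _ fs hHL)

include hDSpull hR hex harith in
/-- **[EtTh] Prop. 4.2 (iii) ∧ (iv) AS TYPED over `B^temp(Π^tp_X)⁰` AT THE FAITHFUL SATURATION SLOT, WITH THE ARITHMETIC
BINDING**: ⟸ {`Φ` divisorial, `hDSpull` (G-w5d063-1), `hR` (G-w4d044-3)} ∪ {B2 data `haug`/`act`/`hact`} ∪ {`hex` ([FrdII]
Rmk. 2.2.1 saturated pull-backs, read in `C`), `harith` («`A_E = Spec(L)`»)} — no binder is headed by a refuted-closure FACT row: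
the Rmk. 2.2.1 root fact is abc-iut-L1-t7's theorem at `ofLocalField`. [cite: MochizukiEtTh2009, Prop 4.2 p.88] -/
theorem Prop42Sub.prop42_iii_iv_mkOfConnectedTemperoid_faithful_arith
    (hΦd : Objectwise (fun M _ => IsDivisorial M) tf.divisorMonoid) :
    (mkOfConnectedTemperoid X tf hZ hP (fun H A N => ∃ (hn : H.Normal)
          (ho : IsOpen (H : Set (Field.absoluteGaloisGroup K))),
          PadicKummer.IsNHSaturated (TemperedFrobenioid.def22Ctx X tf haug A (act A) (hact A) H hn ho) N)
        A₀ hA₀ hA₀').Prop42_iii (fun {_ _} φ x => tf.pullFracModel φ x) ∧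
      (mkOfConnectedTemperoid X tf hZ hP (fun H A N => ∃ (hn : H.Normal)
          (ho : IsOpen (H : Set (Field.absoluteGaloisGroup K))),
          PadicKummer.IsNHSaturated (TemperedFrobenioid.def22Ctx X tf haug A (act A) (hact A) H hn ho) N)
        A₀ hA₀ hA₀').Prop42_iv (fun φ x => tf.pullFracModel φ x) :=
  Prop42Sub.prop42_iii_iv_mkOfConnectedTemperoid_faithful X tf hZ hP haug act hact A₀ hA₀ hA₀' hΦd hDSpull hR hex
    (Prop42Sub.h221_of_arith X tf hZ hP haug act hact A₀ hA₀ hA₀' fs harith)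

end FaithfulArith

end BiKummerSetting

end Literature.AnabelianGeometry.EtaleTheta

end
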